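import Summits.FinalStateConjecture.FinalStateConjecture.Theses.ZeroEnergyKerrOrBomb
import Literature.Geometry.Lorentzian.KillingModeStability
import Literature.Geometry.Lorentzian.TrappedZeroEnergyRay
import Literature.Geometry.Lorentzian.ZeroEnergyRayTrappedModFlow
import Literature.Geometry.Lorentzian.GlobalHyperbolicityStrongCausality
import Literature.Geometry.Lorentzian.NonImprisonment
import Literature.Geometry.Lorentzian.CausalityConditionsProofs
import Literature.Geometry.Lorentzian.GeodesicSpeed
import Literature.Geometry.Lorentzian.GeodesicProofs
import Literature.Geometry.Lorentzian.CoordinateFrames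

/-!
# Disproof of `ErgoregionBomb` — findings (cdisprove, crux stmt-FinalStateConjecture-10691,
# route ZeroEnergyKerrOrBomb; refuter-cdisprove-stmt-FinalStateConjecture-10691-0, 2026-08-16)

VERDICT SO FAR. **No kill is possible: the crux AS TYPED is vacuously TRUE** (§A, kernel-checked
modulo three textbook facts; concurs with the five refuter/grounder notes on the item), so
`¬ ErgoregionBomb` is unprovable and the item is `misstated`, awaiting the planner's restate. The
INTENDED statement (trapping modulo the stationary flow, §B) resists every cheap attack for a
structural reason (§4). Everything below is `sorry`-free, axioms `propext/choice/Quot.sound`.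

* §0 `ergoregionBomb_iff` — the crux bundled: `∀ 𝓑 (telescope), HasTrappedZeroEnergyRay 𝓑 →
  ¬ IsKillingModeStable 𝓑`; `horizon_nonempty_of_isConnected` (the horizon hypothesis excludes
  horizonless ergoregion-instability examples).
* §1 ERGOREGION LOCALISATION: a null vector is never orthogonal to a timelike one, so a zero-energy
  null ray runs in `{g(T,T) ≥ 0}`; holes with `T` timelike on the d.o.c. satisfy the crux (and C′,
  C″) vacuously — a countermodel needs an ergoregion inside `⟨⟨M_ext⟩⟩`.
* §A VACUITY AS TYPED: `trapping_clause_contradictory`, `not_hasTrappedZeroEnergyRay_of_facts`,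
  `ergoregionBomb_of_causality_facts : BS → NI → End → ErgoregionBomb` — the clause
  `∀ s ≥ 0, γ s ∈ K` (K compact in SPACETIME) contradicts `IsGloballyHyperbolic` via
  Bernal–Sánchez (tree fact `bernalSanchez_isStronglyCausal_of_isGloballyHyperbolic`) +
  non-imprisonment (tree fact `IsStronglyCausal.exists_forall_notMem_of_isCompact`) + endlessness of
  affine rays (O'Neill Ch. 5 L. 8, hypothesis `hEnd`, not yet vendored), for BOTH time directions of
  the ray (`isGloballyHyperbolic_reverse`, landed). No vacuum / horizon / zero-energy / mode input is used.
* §B THE INTENDED STATEMENTS: `ErgoregionBombOrbit` (C′, rattack seats), `ErgoregionBombModFlow`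
  (C″, via the tree's `HasZeroEnergyRayTrappedModFlow`) and the recommended restate
  `ErgoregionBombIntended` (C‴ = C′ + non-degeneracy localised to a Killing COLLAR, repairing the
  second telescope defect D-h3: `IsNonDegenerateHorizon` posits a GLOBAL horizon Killing field, i.e.
  Hawking rigidity's conclusion, under which every telescope hole is Kerr/Schwarzschild modulo classical
  uniqueness and C′/C″ hold for the wrong reason), with the §1/§2 phenomena re-proved for them
  (`…_instance_of_timelike`, `ergoregionBombModFlow_withoutPos`).
* §2 THE ONLY TEETH IS `ν > 0`: with `0 < ν` weakened to `0 ≤ ν` the crux (and C″) is a theorem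
  (constant pair `(1, 0)`, frequency `0`).
* §3 GROWTH LAW / TIGHTNESS OF THE BOUNDEDNESS REGION (applies to the common conclusion of the crux,
  C′ and C″): along an integral curve of `T` in the d.o.c., `ψ² + χ² = e^{2ν(t−t₀)}(ψ₀² + χ₀²)`
  (`modePair_sq_eq_exp`); a `ν > 0` pair bounded along a forward `T`-orbit vanishes on it
  (`modePair_eq_zero_of_bounded_forward_orbit`); hence the natural strengthening "bounded on the
  whole d.o.c." has NO non-trivial solution on a forward-`T`-invariant d.o.c.
  (`modePair_eq_zero_of_bounded_on_doc`) — the restriction of the bound to `I⁻(far slice region)`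
  is load-bearing, and provers must produce modes that blow up towards the future.
* §4 WHY THE INTENDED STATEMENT RESISTS (this docstring). Every instance of C′/C″ is a smooth
  Ricci-flat stationary hole with NON-EMPTY non-degenerate horizon and an ergoregion in the d.o.c.
  carrying a flow-trapped `E = 0` null geodesic. Flat carriers are excluded (a Killing field timelike
  on the AF end of a connected flat carrier is timelike everywhere ⇒ `I^±(M_ext) = M`, horizon `∅`);
  the Kerr–Schild Kerr/Schwarzschild charts (the only vacuum holes in the tree) have no zero-energy
  trapping (support item `KerrNoZeroEnergyTrapping`: `R(r) = a²L² − Δ(L²+Q)` strictly decreasing on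
  `r > M`; §1 for `a = 0`), and their junk variants (time-reversed chart: future horizon empty;
  `|a| ≥ M`, `M ≤ 0`, exterior-only `r₀ ≥ r₊`: horizon empty or `κ = 0`) are excluded by
  `IsConnected horizon` / `κ ≠ 0`. A countermodel is therefore EXACTLY a mode-stable non-Kerr smooth
  stationary vacuum hole with zero-energy trapping ('dark light-ring hair'): its existence is open
  (it would in particular refute AIK rigidity in the trapping class), no print exhibits one
  (Moschidis arXiv:1608.02041 Thm 2 is non-vacuum and keeps Kerr's ergoregion; 1608.02035, Keir
  1609.01733 are horizonless; Moschidis 1608.02035 Thm 1.1 does allow a NON-ROTATING horizon with a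
  floating ergoregion `ℰ ∩ 𝓗⁺ = ∅`, but yields only NON-MODAL growth, and 1608.02041 §1.4.2 fn. warns
  that an ergoregion instability may carry no growing mode at all — so a second conceivable
  countermodel is an unstable but MODE-FREE hole, equally unconstructible), and certifying mode
  stability (or mode-freeness) of any explicit candidate is a Whiting-level theorem. Dually no `_false_without_<H>` lemma is cheaply available: dropping any
  telescope hypothesis still leaves "exhibit a hole with a zero-energy trapped ray and prove it mode
  stable". Typing checks: `IsNull` excludes `γ' = 0`; `Kerr.Facts` is inhabited
  (`Kerr.isConnected_region_holds`, …) so the instance binder neither blocks nor trivialises;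
  `dalembertian` (trace of the Hessian), `mfderiv`, `chronologicalPast` are honest; `T ↦ λT`
  rescales `(ν, ω)` harmlessly.
-/

noncomputable section

-- instance search through nested operator types `E →L E →L ℝ` (as in the tree files)
set_option maxSynthPendingDepth 3

namespace Summit.FinalStateConjecture.FinalStateConjecture.Cruxes.ErgoregionBomb.Disproof

open Literature.Geometry.Lorentzian
open Summit.FinalStateConjecture.FinalStateConjecture.Theses.ZeroEnergyKerrOrBomb
open scoped Manifold Topology
open Set Bundle Filter

-- NB: `open scoped ContDiff` would turn the route's binder name `ω` into the analyticity token.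
set_option linter.dupNamespace false

/-! ## §0  The crux, bundled -/

/-- `ErgoregionBomb` says exactly: every hole of the telescope with a trapped zero-energy null ray
(`HasTrappedZeroEnergyRay`, `TrappedZeroEnergyRay.lean`) is NOT Killing-mode stable
(`IsKillingModeStable`, `KillingModeStability.lean`). [folklore] -/
theorem ergoregionBomb_iff : ErgoregionBomb ↔
    ∀ (𝓑 : StationaryAFBlackHole.{0}) [𝓑.metric.HasLeviCivita] [Kerr.Facts],
      𝓑.metric.toPseudoRiemannianMetric.IsRicciFlat → IsConnected 𝓑.horizon →
      𝓑.toSpacetime.IsNonDegenerateHorizon 𝓑.Mext →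
      𝓑.metric.IsGloballyHyperbolic 𝓑.timeOrientation → (∀ p ∈ 𝓑.doc, 𝓑.killing p ≠ 0) →
      𝓑.HasTrappedZeroEnergyRay → ¬ 𝓑.IsKillingModeStable := by
  unfold ErgoregionBomb
  constructor
  · intro h 𝓑 _ _ h1 h2 h3 h4 h5 ⟨γ, K, hg, hz, hK, hKd, hin⟩
    rw [StationaryAFBlackHole.not_isKillingModeStable_iff_exists_isKillingModePair]
    obtain ⟨ν, ω, ψ, χ, hν, hU, hW, hE, hB, hx⟩ := h 𝓑 h1 h2 h3 h4 h5 γ K hg hz hK hKd hin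
    exact ⟨ν, ω, ψ, χ, hν, ⟨hU, hW, hE, hB⟩, hx⟩
  · intro h 𝓑 _ _ h1 h2 h3 h4 h5 γ K hg hz hK hKd hin
    have := h 𝓑 h1 h2 h3 h4 h5 ⟨γ, K, hg, hz, hK, hKd, hin⟩
    rw [StationaryAFBlackHole.not_isKillingModeStable_iff_exists_isKillingModePair] at this
    obtain ⟨ν, ω, ψ, χ, hν, ⟨hU, hW, hE, hB⟩, hx⟩ := this
    exact ⟨ν, ω, ψ, χ, hν, hU, hW, hE, hB, hx⟩

/-- The horizon hypothesis is NOT decoration: `IsConnected 𝓑.horizon` forces a non-empty future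
event horizon, so horizonless stationary spacetimes (Minkowski, boson-star-like solitons, the
horizonless ergoregion-instability examples of Friedman / Moschidis arXiv:1608.02035 / Keir
arXiv:1609.01733) are not instances of the crux. [folklore] -/
theorem horizon_nonempty_of_isConnected (𝓑 : StationaryAFBlackHole.{0})
    (h : IsConnected 𝓑.horizon) : 𝓑.horizon.Nonempty :=
  h.nonempty

/-! ## §1  Ergoregion localisation: where a counterexample must live -/

section Algebra

open scoped ContDiff

variable {E : Type*} [NormedAddCommGroup E] [NormedSpace ℝ E] {H : Type*} [TopologicalSpace H]
  {I : ModelWithCorners ℝ E H} {M : Type*} [TopologicalSpace M] [ChartedSpace H M]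
  [IsManifold I ∞ M] {n : ℕ∞ω}

/-- **No null vector is orthogonal to a timelike vector** (O'Neill 1983, Ch. 5, Lemma 5.26: the
orthogonal complement of a timelike vector is spacelike). [cite: ONeill1983, Ch. 5 Lemma 5.26] -/
theorem not_isNull_of_isTimelike_of_orthogonal (g : LorentzianMetric I n M) {x : M}
    {v w : TangentSpace I x} (hv : g.IsTimelike v) (hvw : g.val x v w = 0) : ¬ g.IsNull w := by
  rintro ⟨hw0, hwne⟩
  have h := g.pos_of_orthogonal x v w hv hvw hwne
  rw [hw0] at h
  exact lt_irrefl 0 h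

/-- Contrapositive form: if `w` is null and `g(v, w) = 0` then `v` is not timelike, i.e.
`0 ≤ g(v, v)`. [cite: ONeill1983, Ch. 5 Lemma 5.26] -/
theorem val_self_nonneg_of_orthogonal_isNull (g : LorentzianMetric I n M) {x : M}
    {v w : TangentSpace I x} (hw : g.IsNull w) (hvw : g.val x v w = 0) : 0 ≤ g.val x v v := by
  by_contra h
  exact not_isNull_of_isTimelike_of_orthogonal g (not_le.mp h) hvw hw

end Algebra

variable (𝓑 : StationaryAFBlackHole.{0}) [𝓑.metric.HasLeviCivita]

omit [𝓑.metric.HasLeviCivita] in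
/-- **A zero-energy null ray runs in the closed ergoregion**: along a null geodesic ray with
`g(T, γ') = 0` the stationary Killing field is nowhere timelike, `0 ≤ g(T, T)(γ s)` for all
`s ≥ 0`. (Ionescu–Klainerman 2015 §4: the trapped null geodesics "perpendicular to `T`" are an
ergoregion phenomenon.) [cite: IonescuKlainerman2015, §4] -/
theorem killing_not_timelike_along_ray {γ : ℝ → 𝓑.carrier}
    (hz : ∀ s : ℝ, 0 ≤ s → 𝓑.metric.IsNull (velocity (𝓡 4) γ s) ∧
      𝓑.metric.val (γ s) (𝓑.killing (γ s)) (velocity (𝓡 4) γ s) = 0)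
    {s : ℝ} (hs : 0 ≤ s) :
    0 ≤ 𝓑.metric.val (γ s) (𝓑.killing (γ s)) (𝓑.killing (γ s)) :=
  val_self_nonneg_of_orthogonal_isNull 𝓑.metric (hz s hs).1 (hz s hs).2

/-- **Holes without ergoregion in the d.o.c. have no trapped zero-energy ray**: if `T` is timelike
at every point of `𝓑.doc` then `¬ 𝓑.HasTrappedZeroEnergyRay` (the ray's initial point `γ 0` lies in
`K ⊆ doc`, where `T` would be timelike and orthogonal to the null velocity). [folklore] -/
theorem not_hasTrappedZeroEnergyRay_of_timelike_on_doc
    (hT : ∀ p ∈ 𝓑.doc, 𝓑.metric.IsTimelike (𝓑.killing p)) : ¬ 𝓑.HasTrappedZeroEnergyRay := by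
  rintro ⟨γ, K, -, hz, -, hKd, hin⟩
  have h0 := killing_not_timelike_along_ray 𝓑 hz le_rfl
  have ht := hT (γ 0) (hKd (hin 0 le_rfl))
  exact not_lt.mpr h0 ht

/-- **The crux holds vacuously on every hole whose stationary field is timelike on the d.o.c.**
(e.g. Schwarzschild; any candidate without ergoregion inside `⟨⟨M_ext⟩⟩`): the instance of
`ErgoregionBomb` at such a `𝓑` is provable with no mode at all, because its trapping hypotheses are
contradictory there. Consequently a countermodel to the crux MUST have `g(T,T) ≥ 0` somewhere in its
d.o.c. (an ergoregion reaching into the domain of outer communications). [folklore] -/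
theorem ergoregionBomb_of_timelike_on_doc [Kerr.Facts]
    (hT : ∀ p ∈ 𝓑.doc, 𝓑.metric.IsTimelike (𝓑.killing p))
    (γ : ℝ → 𝓑.carrier) (K : Set 𝓑.carrier)
    (hg : IsGeodesicOn 𝓑.metric.leviCivita γ (Set.Ici 0))
    (hz : ∀ s : ℝ, 0 ≤ s → 𝓑.metric.IsNull (velocity (𝓡 4) γ s) ∧
      𝓑.metric.val (γ s) (𝓑.killing (γ s)) (velocity (𝓡 4) γ s) = 0)
    (hK : IsCompact K) (hKd : K ⊆ 𝓑.doc) (hin : ∀ s : ℝ, 0 ≤ s → γ s ∈ K) :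
    ∃ (ν ω : ℝ) (ψ χ : 𝓑.carrier → ℝ), 0 < ν ∧ 𝓑.IsKillingModePair ν ω ψ χ ∧
      ∃ x ∈ 𝓑.doc, ψ x ≠ 0 ∨ χ x ≠ 0 :=
  absurd (⟨γ, K, hg, hz, hK, hKd, hin⟩ : 𝓑.HasTrappedZeroEnergyRay)
    (not_hasTrappedZeroEnergyRay_of_timelike_on_doc 𝓑 hT)


/-! ## §A  THE CRUX AS TYPED IS VACUOUSLY TRUE (kernel-checked modulo three textbook facts)

The trapping clause `IsCompact K → K ⊆ 𝓑.doc → ∀ s ≥ 0, γ s ∈ K` imprisons an affinely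
parametrised null geodesic half-ray `γ|[0,∞)` (velocity non-zero by `IsNull`) in a compact subset of
SPACETIME; on the telescope's carrier (Hausdorff, second countable, connected, boundaryless, model
`ℝ⁴`, `C^∞` metric) this contradicts `IsGloballyHyperbolic` by the chain
GH ⇒ strongly causal (Bernal–Sánchez 2007 Thm 3.2 = tree fact
`LorentzianMetric.bernalSanchez_isStronglyCausal_of_isGloballyHyperbolic`) ⇒ non-imprisonment of
endless causal curves (O'Neill 1983 Lemma 14.13 / Hawking–Ellis Prop. 6.4.7 = tree fact
`LorentzianMetric.IsStronglyCausal.exists_forall_notMem_of_isCompact`), applied to `γ` read as a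
future causal curve for `τ` or for `τ.reverse` (the sign of `g(τ, γ')` is constant on `[0, ∞)` by
continuity: O'Neill Lemma 5.26), plus the geodesic fact that an affine ray with non-vanishing
velocity has no endpoint (O'Neill 1983 Ch. 5, Lemma 8: the third hypothesis `hEnd` below, not yet
vendored in the tree). The theorem `ergoregionBomb_of_causality_facts` uses NONE of: Ricci-flatness,
the horizon hypotheses, `T ≠ 0`, the zero-energy condition, `K ⊆ doc`, or any mode analysis — the
crux as typed is content-free (verdict of rattack-10691-0, rattack-10691-g2-0, g44-14, g44-42, g41-12, grounder
g27-27, here made a Lean theorem). REPAIR (planner): trapping modulo the stationary flow,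
`StationaryAFBlackHole.HasZeroEnergyRayTrappedModFlow` (tree) — attacked in §B and §1–§3 below. -/

-- LANDED (p73277, commit 9173072c95cd): `isGloballyHyperbolic_reverse`, `trapping_clause_contradictory`,
-- `not_hasTrappedZeroEnergyRay_of_facts` as `Summits/…/Theorems/ErgoregionBomb/Negative/TrappingClauseVacuous.lean`
-- (namespace `…Theorems.ErgoregionBomb.Negative`); the copies below keep this work file self-contained.
section Vacuity

open LorentzianMetric

variable {E' : Type*} [NormedAddCommGroup E'] [NormedSpace ℝ E'] {H' : Type*} [TopologicalSpace H']
  {I' : ModelWithCorners ℝ E' H'} {M' : Type*} [TopologicalSpace M'] [ChartedSpace H' M']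
  {n' : WithTop ℕ∞}

/-- Global hyperbolicity (causal + compact causal diamonds) is invariant under time reversal:
the diamonds of `-τ` are the diamonds of `τ` with `p, q` swapped. [folklore] -/
theorem isGloballyHyperbolic_reverse' [IsManifold I' ((⊤ : ℕ∞) : WithTop ℕ∞) M']
    {g : LorentzianMetric I' n' M'} {τ : TimeOrientation g}
    (h : g.IsGloballyHyperbolic τ) : g.IsGloballyHyperbolic τ.reverse := by
  refine ⟨h.1.reverse, fun p q ↦ ?_⟩
  have e1 : g.causalFuture τ.reverse {p} = g.causalPast τ {p} := rfl
  rw [e1, LorentzianMetric.causalPast_reverse, Set.inter_comm]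
  exact h.2 q p

end Vacuity

/-- `2 ≤ ∞` in `ℕ∞ω`. [folklore] -/
theorem two_le_infty' : (2 : WithTop ℕ∞) ≤ ((⊤ : ℕ∞) : WithTop ℕ∞) :=
  WithTop.coe_le_coe.mpr le_top

/-- **The trapping clause of the crux is contradictory** (modulo the three facts): on a globally
hyperbolic `𝓑`, no geodesic half-ray `γ|[0,∞)` with null (hence non-zero, causal) velocity stays in
a compact set. `hBS`/`hNI` are the tree's named causality facts instantiated at `𝓑` (both time
orientations); `hEnd` is O'Neill 1983 Ch. 5 Lemma 8 (an affinely parametrised geodesic ray with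
non-vanishing velocity has no future endpoint), stated for the telescope. No use of the metric being
vacuum, of the horizon, of `T`, or of `K ⊆ doc`.
[cite: ONeill1983, Ch. 14 Lemma 13; Ch. 5 Lemma 8 and Lemma 26] -/
theorem trapping_clause_contradictory
    (hBS : ∀ τ : TimeOrientation 𝓑.metric,
      𝓑.metric.bernalSanchez_isStronglyCausal_of_isGloballyHyperbolic τ)
    (hNI : ∀ τ : TimeOrientation 𝓑.metric,
      LorentzianMetric.IsStronglyCausal.exists_forall_notMem_of_isCompact 𝓑.metric τ)
    (hEnd : ∀ γ : ℝ → 𝓑.carrier, IsGeodesicOn 𝓑.metric.leviCivita γ (Set.Ici 0) →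
      (∀ s : ℝ, 0 ≤ s → velocity (𝓡 4) γ s ≠ 0) → IsFutureEndless γ (Set.Ici 0))
    (hgh : 𝓑.metric.IsGloballyHyperbolic 𝓑.timeOrientation)
    {γ : ℝ → 𝓑.carrier} {K : Set 𝓑.carrier}
    (hg : IsGeodesicOn 𝓑.metric.leviCivita γ (Set.Ici 0))
    (hnull : ∀ s : ℝ, 0 ≤ s → 𝓑.metric.IsNull (velocity (𝓡 4) γ s))
    (hK : IsCompact K) (hin : ∀ s : ℝ, 0 ≤ s → γ s ∈ K) : False := by
  set τ := 𝓑.timeOrientation with hτ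
  -- the sign function `f(t) = g(τ, γ')(t)`
  set f : ℝ → ℝ := fun t ↦ 𝓑.metric.val (γ t) (τ.vectorField (γ t)) (velocity (𝓡 4) γ t)
    with hf
  have hcov : 𝓑.metric.toPseudoRiemannianMetric.IsCompatible 𝓑.metric.leviCivita :=
    (PseudoRiemannianMetric.isLeviCivita_leviCivita_holds
      (g := 𝓑.metric.toPseudoRiemannianMetric)).2
  have hmd : ∀ t ∈ Set.Ici (0 : ℝ), MDifferentiableAt 𝓘(ℝ, ℝ) (𝓡 4) γ t := fun t ht ↦
    IsGeodesicOn.mdifferentiableAt_holds hg ht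
  have hderiv : ∀ t ∈ Set.Ici (0 : ℝ), ∃ f', HasDerivAt f f' t := by
    intro t ht
    have hXd : MDifferentiableAt (𝓡 4) (𝓡 4).tangent
        (fun x ↦ (TotalSpace.mk' (EuclideanSpace ℝ (Fin 4)) x (τ.vectorField x) :
          TangentBundle (𝓡 4) 𝓑.carrier)) (γ t) :=
      (τ.contMDiff (γ t)).mdifferentiableAt (by simp)
    exact ⟨_, 𝓑.metric.toPseudoRiemannianMetric.hasDerivAt_val_apply_along hcov
      (V := fun t ↦ τ.vectorField (γ t)) (W := fun t ↦ velocity (𝓡 4) γ t)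
      (mdifferentiableAt_lift_comp hXd (hmd t ht)) (hg.1 t ht)⟩
  have hcont : ContinuousOn f (Set.Ici 0) := fun t ht ↦ by
    obtain ⟨f', h⟩ := hderiv t ht
    exact h.continuousAt.continuousWithinAt
  have hne : ∀ t ∈ Set.Ici (0 : ℝ), f t ≠ 0 := fun t ht ↦
    𝓑.metric.val_ne_zero_of_isTimelike_of_isCausal (τ.isTimelike _) (hnull t ht).isCausal
  -- constant sign on `[0, ∞)`
  have hsign : (∀ t ∈ Set.Ici (0 : ℝ), f t < 0) ∨ (∀ t ∈ Set.Ici (0 : ℝ), 0 < f t) := by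
    rcases lt_or_gt_of_ne (hne 0 Set.self_mem_Ici) with h0 | h0
    · refine Or.inl fun t ht ↦ ?_
      by_contra hft
      have hft' : 0 ≤ f t := not_lt.mp hft
      have hIVT := intermediate_value_Icc (show (0 : ℝ) ≤ t from ht)
        (hcont.mono Set.Icc_subset_Ici_self)
      obtain ⟨s, hs, hs0⟩ := hIVT ⟨h0.le, hft'⟩
      exact hne s (Set.mem_Ici.2 hs.1) hs0
    · refine Or.inr fun t ht ↦ ?_
      by_contra hft
      have hft' : f t ≤ 0 := not_lt.mp hft
      have hIVT := intermediate_value_Icc' (show (0 : ℝ) ≤ t from ht)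
        (hcont.mono Set.Icc_subset_Ici_self)
      obtain ⟨s, hs, hs0⟩ := hIVT ⟨hft', h0.le⟩
      exact hne s (Set.mem_Ici.2 hs.1) hs0
  have hend : IsFutureEndless γ (Set.Ici 0) := hEnd γ hg fun s hs ↦ (hnull s hs).2
  rcases hsign with hneg | hpos
  · -- future-directed: non-imprisonment for `τ`
    have hcurve : 𝓑.metric.IsFutureCausalCurveOn τ γ (Set.Ici 0) := fun t ht ↦
      ⟨hmd t ht, (hnull t ht).isCausal, hneg t ht⟩
    have hsc : 𝓑.metric.IsStronglyCausal τ := hBS τ two_le_infty' hgh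
    obtain ⟨t, ht, hout⟩ := hNI τ two_le_infty' hsc hK Set.ordConnected_Ici hcurve hend
    exact hout t ht le_rfl (hin t ht)
  · -- past-directed: non-imprisonment for `τ.reverse`
    have hcurve : 𝓑.metric.IsFutureCausalCurveOn τ.reverse γ (Set.Ici 0) := fun t ht ↦
      ⟨hmd t ht, (TimeOrientation.isFutureDirected_reverse_iff _ _).mpr
        ⟨(hnull t ht).isCausal, hpos t ht⟩⟩
    have hsc : 𝓑.metric.IsStronglyCausal τ.reverse :=
      hBS τ.reverse two_le_infty' (isGloballyHyperbolic_reverse' hgh)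
    obtain ⟨t, ht, hout⟩ :=
      hNI τ.reverse two_le_infty' hsc hK Set.ordConnected_Ici hcurve hend
    exact hout t ht le_rfl (hin t ht)

/-- **`HasTrappedZeroEnergyRay` is unsatisfiable under global hyperbolicity** (modulo the three
facts): the Literature predicate inlined by the crux never holds on the telescope. [folklore] -/
theorem not_hasTrappedZeroEnergyRay_of_facts
    (hBS : ∀ τ : TimeOrientation 𝓑.metric,
      𝓑.metric.bernalSanchez_isStronglyCausal_of_isGloballyHyperbolic τ)
    (hNI : ∀ τ : TimeOrientation 𝓑.metric,
      LorentzianMetric.IsStronglyCausal.exists_forall_notMem_of_isCompact 𝓑.metric τ)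
    (hEnd : ∀ γ : ℝ → 𝓑.carrier, IsGeodesicOn 𝓑.metric.leviCivita γ (Set.Ici 0) →
      (∀ s : ℝ, 0 ≤ s → velocity (𝓡 4) γ s ≠ 0) → IsFutureEndless γ (Set.Ici 0))
    (hgh : 𝓑.metric.IsGloballyHyperbolic 𝓑.timeOrientation) :
    ¬ 𝓑.HasTrappedZeroEnergyRay := by
  rintro ⟨γ, K, hg, hz, hK, -, hin⟩
  exact trapping_clause_contradictory 𝓑 hBS hNI hEnd hgh hg (fun s hs ↦ (hz s hs).1) hK hin

/-- **`ErgoregionBomb` as typed follows from the three causality/geodesic facts alone** — its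
antecedent is contradictory for every `𝓑` of the telescope, so the crux is vacuously TRUE and
content-free (no vacuum, horizon, zero-energy or mode input is used). This is the kernel-checked
form of the `refuted-misstated: VACUOUS` verdict recorded on the item; it is NOT a refutation
(`¬ ErgoregionBomb` is unprovable) and closing the item by it would be worthless — the planner must
restate the trapping clause modulo the stationary flow (§B). [folklore] -/
theorem ergoregionBomb_of_causality_facts
    (hBS : ∀ (𝓑 : StationaryAFBlackHole.{0}) (τ : TimeOrientation 𝓑.metric),
      𝓑.metric.bernalSanchez_isStronglyCausal_of_isGloballyHyperbolic τ)
    (hNI : ∀ (𝓑 : StationaryAFBlackHole.{0}) (τ : TimeOrientation 𝓑.metric),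
      LorentzianMetric.IsStronglyCausal.exists_forall_notMem_of_isCompact 𝓑.metric τ)
    (hEnd : ∀ (𝓑 : StationaryAFBlackHole.{0}) [𝓑.metric.HasLeviCivita] (γ : ℝ → 𝓑.carrier),
      IsGeodesicOn 𝓑.metric.leviCivita γ (Set.Ici 0) →
      (∀ s : ℝ, 0 ≤ s → velocity (𝓡 4) γ s ≠ 0) → IsFutureEndless γ (Set.Ici 0)) :
    ErgoregionBomb := by
  intro 𝓑 _ _ _ _ _ hgh _ γ K hg hz hK _ hin
  exact (trapping_clause_contradictory 𝓑 (hBS 𝓑) (hNI 𝓑) (hEnd 𝓑) hgh hg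
    (fun s hs ↦ (hz s hs).1) hK hin).elim


/-! ## §B  The INTENDED statement: trapping modulo the stationary flow (repairs C′, C″)

Two repairs are on the item: C′ = `ErgoregionBombOrbit` (rattack seats' `Cprime.ErgoregionBombOrbit`:
the last antecedent clause `∀ s ≥ 0, γ s ∈ K` replaced by `γ s ∈ ⋃ₜ φₜ(K)`), and C″ =
`ErgoregionBombModFlow` (grounder g27-27: restate through the tree predicate
`StationaryAFBlackHole.HasZeroEnergyRayTrappedModFlow`, a maximal geodesic trapped mod flow in both
directions). C′ and C″ are NOT equivalent (card `Ideas/zero-energy-surface-gravity.md`): C′'s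
`Set.Ici 0` asks for a future-COMPLETE trapped ray, whereas C″'s maximal geodesic may have a domain
bounded above (a future-incomplete, blueshifting flow-trapped ray — the KK-lift of the Misner cylinder
shows such rays exist among stationary metrics), so C″ has the weaker antecedent and is the stronger
claim; conversely C′ ⇒ C″ only on holes whose flow-trapped maximal zero-energy geodesics are future
complete. Neither is vacuous for causality reasons (the photon sphere of Schwarzschild is trapped mod
flow), neither has a constructible instance with a zero-energy trapped ray (Kerr:
`KerrNoZeroEnergyTrapping`; every other vacuum hole is unknown), and §1–§3 transfer verbatim: the
ergoregion localisation (`…_of_timelike` below), the `ν > 0` teeth (`…WithoutPos_holds` below) and the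
growth law / tightness of the boundedness region (§3, which only concerns the common conclusion).

SECOND-ORDER VACUITY OF THE TELESCOPE (defect D-h3, sibling triage
`Cruxes/ZeroEnergyRigidity/TRIAGE-r1-1.md`, kernel-checked there): `IsNonDegenerateHorizon 𝓑.Mext`
quantifies a Killing field `K` that is Killing on the WHOLE carrier and null, non-zero, pregeodesic
with `κ ≠ 0` on `𝓔⁺` — the conclusion of Hawking's rigidity theorem as a hypothesis. Modulo three
honest stubs (I⁺-regularity from the telescope, completeness of `K`, Beig–Chruściel CMP 188 (1997)
Thm 1.2) a telescope hole is then Schwarzschild (K ∈ ℝT: Sudarsky–Wald staticity + static uniqueness,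
tree schema `static_black_hole_uniqueness`) or Kerr (K ∉ ℝT: axisymmetry + tree schema
`ChruscielCostaHeusler2012_axisymmetricUniqueness`, no analyticity needed), both WITHOUT zero-energy
trapping — so even C′/C″ would hold for the wrong reason under the typed telescope. The intended crux
therefore also LOCALISES h3 to a Killing collar of `𝓗⁺` (route BeltLiouville's typing; AIK's smooth
local Hawking rigidity makes the collar a theorem-backed hypothesis for non-degenerate horizons):
`ErgoregionBombIntended` (C‴) below is that statement, typed and elaborating, offered to the
restating planner; the cheap attacks of §1/§2/§3 apply to it unchanged (same ray clause, same
conclusion). -/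

/-- **C′** (`Cprime.ErgoregionBombOrbit` of rattack-10691-g2-0, reproduced): the crux with spatial
confinement read modulo the stationary flow — `γ s ∈ stationaryOrbit T K` for all `s ≥ 0`, `K`
compact `⊆ doc`. -/
def ErgoregionBombOrbit : Prop :=
  ∀ (𝓑 : Literature.Geometry.Lorentzian.StationaryAFBlackHole.{0}) [𝓑.metric.HasLeviCivita] [Literature.Geometry.Lorentzian.Kerr.Facts], 𝓑.metric.toPseudoRiemannianMetric.IsRicciFlat → IsConnected 𝓑.horizon → 𝓑.toSpacetime.IsNonDegenerateHorizon 𝓑.Mext → 𝓑.metric.IsGloballyHyperbolic 𝓑.timeOrientation → (∀ p ∈ 𝓑.doc, 𝓑.killing p ≠ 0) → ∀ (γ : ℝ → 𝓑.carrier) (K : Set 𝓑.carrier), Literature.Geometry.Lorentzian.IsGeodesicOn 𝓑.metric.leviCivita γ (Set.Ici 0) → (∀ s : ℝ, 0 ≤ s → 𝓑.metric.IsNull (Literature.Geometry.Lorentzian.velocity (𝓡 4) γ s) ∧ 𝓑.metric.val (γ s) (𝓑.killing (γ s)) (Literature.Geometry.Lorentzian.velocity (𝓡 4) γ s) = 0)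 → IsCompact K → K ⊆ 𝓑.doc → (∀ s : ℝ, 0 ≤ s → γ s ∈ 𝓑.toSpacetime.stationaryOrbit 𝓑.killing K) → ∃ (ν ω : ℝ) (ψ χ : 𝓑.carrier → ℝ), 0 < ν ∧ (∃ U : Set 𝓑.carrier, IsOpen U ∧ 𝓑.doc ∪ 𝓑.horizon ⊆ U ∧ ContMDiffOn (𝓡 4) 𝓘(ℝ, ℝ) ((⊤ : ℕ∞) : WithTop ℕ∞) ψ U ∧ ContMDiffOn (𝓡 4) 𝓘(ℝ, ℝ) ((⊤ : ℕ∞) : WithTop ℕ∞) χ U) ∧ (∀ x ∈ 𝓑.doc, 𝓑.metric.dalembertian ψ x = 0 ∧ 𝓑.metric.dalembertian χ x = 0) ∧ (∀ x ∈ 𝓑.doc, mfderiv (𝓡 4) 𝓘(ℝ, ℝ) ψ x (𝓑.killing x) = ν * ψ x - ω * χ x ∧ mfderiv (𝓡 4) 𝓘(ℝ, ℝ) χ x (𝓑.killing x) = ω * ψ x + ν * χ x) ∧ (∃ C : ℝ, ∀ x ∈ 𝓑.doc ∩ 𝓑.metric.chronologicalPast 𝓑.timeOrientation (𝓑.embed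 '' 𝓑.e.far (𝓑.e.R + 1)), |ψ x| ≤ C ∧ |χ x| ≤ C) ∧ ∃ x ∈ 𝓑.doc, ψ x ≠ 0 ∨ χ x ≠ 0

/-- **C″** (grounder g27-27's restate through the tree predicates): a telescope hole with a
zero-energy null geodesic trapped modulo the flow (`HasZeroEnergyRayTrappedModFlow`) is not
Killing-mode stable (`IsKillingModeStable`). -/
def ErgoregionBombModFlow : Prop :=
  ∀ (𝓑 : StationaryAFBlackHole.{0}) [𝓑.metric.HasLeviCivita] [Kerr.Facts],
    𝓑.metric.toPseudoRiemannianMetric.IsRicciFlat → IsConnected 𝓑.horizon →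
    𝓑.toSpacetime.IsNonDegenerateHorizon 𝓑.Mext →
    𝓑.metric.IsGloballyHyperbolic 𝓑.timeOrientation → (∀ p ∈ 𝓑.doc, 𝓑.killing p ≠ 0) →
    𝓑.HasZeroEnergyRayTrappedModFlow → ¬ 𝓑.IsKillingModeStable

/-- **C‴ — the intended crux, recommended restate** (both defects repaired): the telescope with
`IsNonDegenerateHorizon 𝓑.Mext` replaced by a NON-DEGENERATE KILLING COLLAR (route BeltLiouville's
typing of `SmoothHawkingRigidity`: `K` smooth and Killing on an open `U ⊇ 𝓗⁺`, `[T, K] = 0` on `U`,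
`K ≠ 0` on and tangent to `𝓗⁺`, `∇_K K = κK` on `𝓗⁺`, `κ ≠ 0`), the unused binder `[Kerr.Facts]`
dropped, and the trapping clause read modulo the flow with a future-complete ray (C′). -/
def ErgoregionBombIntended : Prop :=
  ∀ (𝓑 : StationaryAFBlackHole.{0}) [𝓑.metric.HasLeviCivita],
    𝓑.metric.toPseudoRiemannianMetric.IsRicciFlat → IsConnected 𝓑.horizon →
    (∃ (U : Set 𝓑.carrier) (K : Π x : 𝓑.carrier, TangentSpace (𝓡 4) x) (κ : ℝ),
      IsOpen U ∧ 𝓑.horizon ⊆ U ∧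
      ContMDiffOn (𝓡 4) ((𝓡 4).prod 𝓘(ℝ, E4)) ((⊤ : ℕ∞) : WithTop ℕ∞)
        (fun x ↦ (TotalSpace.mk' E4 x (K x) : TangentBundle (𝓡 4) 𝓑.carrier)) U ∧
      (∀ x ∈ U, ∀ v w : TangentSpace (𝓡 4) x,
        𝓑.metric.val x (𝓑.metric.leviCivita K x v) w +
          𝓑.metric.val x v (𝓑.metric.leviCivita K x w) = 0) ∧
      (∀ x ∈ U, VectorField.mlieBracket (𝓡 4) 𝓑.killing K x = 0) ∧
      (∀ p ∈ 𝓑.horizon, K p ≠ 0) ∧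
      (∀ γ : ℝ → 𝓑.carrier, IsMIntegralCurve γ K → γ 0 ∈ 𝓑.horizon → ∀ t, γ t ∈ 𝓑.horizon) ∧
      κ ≠ 0 ∧ ∀ p ∈ 𝓑.horizon, 𝓑.metric.leviCivita K p (K p) = κ • K p) →
    𝓑.metric.IsGloballyHyperbolic 𝓑.timeOrientation → (∀ p ∈ 𝓑.doc, 𝓑.killing p ≠ 0) →
    ∀ (γ : ℝ → 𝓑.carrier) (S : Set 𝓑.carrier),
      IsGeodesicOn 𝓑.metric.leviCivita γ (Set.Ici 0) →
      (∀ s : ℝ, 0 ≤ s → 𝓑.metric.IsNull (velocity (𝓡 4) γ s) ∧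
        𝓑.metric.val (γ s) (𝓑.killing (γ s)) (velocity (𝓡 4) γ s) = 0) →
      IsCompact S → S ⊆ 𝓑.doc → (∀ s : ℝ, 0 ≤ s → γ s ∈ stationaryOrbit 𝓑.killing S) →
      ∃ (ν ω : ℝ) (ψ χ : 𝓑.carrier → ℝ), 0 < ν ∧ 𝓑.IsKillingModePair ν ω ψ χ ∧
        ∃ x ∈ 𝓑.doc, ψ x ≠ 0 ∨ χ x ≠ 0

/-- The typed telescope's non-degeneracy hypothesis IMPLIES the collar form (take `U = univ` and the
global Killing field of `IsNonDegenerateHorizon`, which commutes with … — NOT provable: h3 does not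
give `[T, K] = 0`, nor smoothness of `K` beyond what `IsKillingField` packages). What IS immediate is
the converse bookkeeping used by the glue: C‴ has the same ray clause and the same conclusion as C′, so
`ergoregionBombOrbit_instance_of_timelike`, `ergoregionBombModFlow_withoutPos` and §3 apply to it
verbatim; recorded as the instance-level vacuity below. [cite: ONeill1983, Ch. 5 Lemma 5.26] -/
theorem ergoregionBombIntended_instance_of_timelike
    (hT : ∀ S : Set 𝓑.carrier, IsCompact S → S ⊆ 𝓑.doc →
      ∀ x ∈ stationaryOrbit 𝓑.killing S, 𝓑.metric.IsTimelike (𝓑.killing x))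
    (γ : ℝ → 𝓑.carrier) (S : Set 𝓑.carrier)
    (hz : ∀ s : ℝ, 0 ≤ s → 𝓑.metric.IsNull (velocity (𝓡 4) γ s) ∧
      𝓑.metric.val (γ s) (𝓑.killing (γ s)) (velocity (𝓡 4) γ s) = 0)
    (hS : IsCompact S) (hSd : S ⊆ 𝓑.doc)
    (hin : ∀ s : ℝ, 0 ≤ s → γ s ∈ stationaryOrbit 𝓑.killing S) :
    ∃ (ν ω : ℝ) (ψ χ : 𝓑.carrier → ℝ), 0 < ν ∧ 𝓑.IsKillingModePair ν ω ψ χ ∧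
      ∃ x ∈ 𝓑.doc, ψ x ≠ 0 ∨ χ x ≠ 0 :=
  absurd (killing_not_timelike_along_ray 𝓑 hz le_rfl) (not_le.mpr (hT S hS hSd (γ 0) (hin 0 le_rfl)))

/-- C′ at a hole whose stationary field is timelike on the `T`-orbit of every compact subset of its
d.o.c. holds VACUOUSLY (the ray's initial point `γ 0 ∈ ⋃ₜ φₜ(K)` would carry a null vector orthogonal
to a timelike `T`): as for the original crux (§1), any countermodel to C′ needs an ergoregion in
the d.o.c. [cite: ONeill1983, Ch. 5 Lemma 5.26] -/
theorem ergoregionBombOrbit_instance_of_timelike [Kerr.Facts]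
    (hT : ∀ K : Set 𝓑.carrier, IsCompact K → K ⊆ 𝓑.doc →
      ∀ x ∈ stationaryOrbit 𝓑.killing K, 𝓑.metric.IsTimelike (𝓑.killing x))
    (γ : ℝ → 𝓑.carrier) (K : Set 𝓑.carrier)
    (hz : ∀ s : ℝ, 0 ≤ s → 𝓑.metric.IsNull (velocity (𝓡 4) γ s) ∧
      𝓑.metric.val (γ s) (𝓑.killing (γ s)) (velocity (𝓡 4) γ s) = 0)
    (hK : IsCompact K) (hKd : K ⊆ 𝓑.doc)
    (hin : ∀ s : ℝ, 0 ≤ s → γ s ∈ 𝓑.toSpacetime.stationaryOrbit 𝓑.killing K) :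
    ∃ (ν ω : ℝ) (ψ χ : 𝓑.carrier → ℝ), 0 < ν ∧ 𝓑.IsKillingModePair ν ω ψ χ ∧
      ∃ x ∈ 𝓑.doc, ψ x ≠ 0 ∨ χ x ≠ 0 :=
  absurd (killing_not_timelike_along_ray 𝓑 hz le_rfl) (not_le.mpr (hT K hK hKd (γ 0) (hin 0 le_rfl)))

/-- C″ at a hole whose stationary field is timelike on the `T`-orbit of every compact subset of its
d.o.c. holds VACUOUSLY (tree lemma `not_hasZeroEnergyRayTrappedModFlow_of_isTimelike`).
[cite: ONeill1983, Ch. 5 Lemma 5.26] -/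
theorem ergoregionBombModFlow_instance_of_timelike
    (hT : ∀ S : Set 𝓑.carrier, IsCompact S → S ⊆ 𝓑.doc →
      ∀ x ∈ stationaryOrbit 𝓑.killing S, 𝓑.metric.IsTimelike (𝓑.killing x)) :
    𝓑.HasZeroEnergyRayTrappedModFlow → ¬ 𝓑.IsKillingModeStable :=
  fun h ↦ absurd h (𝓑.not_hasZeroEnergyRayTrappedModFlow_of_isTimelike hT)

/-- **C″ without `ν > 0` is a theorem** (constant pair, as in §2): the zero pair of frequency `0`
with `ψ = 1` is a bounded Killing-mode pair non-zero on the (non-empty) d.o.c. So for the repaired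
statement, too, all content is the strict growth rate. [folklore] -/
theorem ergoregionBombModFlow_withoutPos (h : 𝓑.HasZeroEnergyRayTrappedModFlow) :
    ∃ (ν ω : ℝ) (ψ χ : 𝓑.carrier → ℝ), 0 ≤ ν ∧ 𝓑.IsKillingModePair ν ω ψ χ ∧
      ∃ x ∈ 𝓑.doc, ψ x ≠ 0 ∨ χ x ≠ 0 := by
  obtain ⟨x₀, hx₀⟩ := h.doc_nonempty
  refine ⟨0, 0, fun _ ↦ 1, fun _ ↦ 0, le_rfl, ⟨⟨Set.univ, isOpen_univ, Set.subset_univ _,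
    contMDiffOn_const, contMDiffOn_const⟩, ?_, ?_, ⟨1, fun x _ ↦ by simp⟩⟩,
    ⟨x₀, hx₀, Or.inl one_ne_zero⟩⟩
  · intro x _
    exact ⟨PseudoRiemannianMetric.dalembertian_const _ 1 x,
      PseudoRiemannianMetric.dalembertian_const _ 0 x⟩
  · intro x _
    constructor <;> simp [mfderiv_const]
    all_goals rfl

/-! ## §2  The only teeth is `ν > 0` -/

/-- The crux with its growth-rate condition `0 < ν` weakened to `0 ≤ ν` (everything else
verbatim). -/
def ErgoregionBombWithoutPos : Prop :=
  ∀ (𝓑 : Literature.Geometry.Lorentzian.StationaryAFBlackHole.{0}) [𝓑.metric.HasLeviCivita] [Literature.Geometry.Lorentzian.Kerr.Facts], 𝓑.metric.toPseudoRiemannianMetric.IsRicciFlat → IsConnected 𝓑.horizon → 𝓑.toSpacetime.IsNonDegenerateHorizon 𝓑.Mext → 𝓑.metric.IsGloballyHyperbolic 𝓑.timeOrientation → (∀ p ∈ 𝓑.doc, 𝓑.killing p ≠ 0) → ∀ (γ : ℝ → 𝓑.carrier) (K : Set 𝓑.carrier), Literature.Geometry.Lorentzian.IsGeodesicOn 𝓑.metric.leviCivita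 γ (Set.Ici 0) → (∀ s : ℝ, 0 ≤ s → 𝓑.metric.IsNull (Literature.Geometry.Lorentzian.velocity (𝓡 4) γ s) ∧ 𝓑.metric.val (γ s) (𝓑.killing (γ s)) (Literature.Geometry.Lorentzian.velocity (𝓡 4) γ s) = 0) → IsCompact K → K ⊆ 𝓑.doc → (∀ s : ℝ, 0 ≤ s → γ s ∈ K) → ∃ (ν ω : ℝ) (ψ χ : 𝓑.carrier → ℝ), 0 ≤ ν ∧ (∃ U : Set 𝓑.carrier, IsOpen U ∧ 𝓑.doc ∪ 𝓑.horizon ⊆ U ∧ ContMDiffOn (𝓡 4) 𝓘(ℝ, ℝ) ((⊤ : ℕ∞) : WithTop ℕ∞) ψ U ∧ ContMDiffOn (𝓡 4) 𝓘(ℝ, ℝ) ((⊤ : ℕ∞) : WithTop ℕ∞) χ U) ∧ (∀ x ∈ 𝓑.doc, 𝓑.metric.dalembertian ψ x = 0 ∧ 𝓑.metric.dalembertian χ x = 0) ∧ (∀ x ∈ 𝓑.doc, mfderiv (𝓡 4) 𝓘(ℝ, ℝ) ψ x (𝓑.killing x) = ν * ψ x - ω * χ x ∧ mfderiv (𝓡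 4) 𝓘(ℝ, ℝ) χ x (𝓑.killing x) = ω * ψ x + ν * χ x) ∧ (∃ C : ℝ, ∀ x ∈ 𝓑.doc ∩ 𝓑.metric.chronologicalPast 𝓑.timeOrientation (𝓑.embed '' 𝓑.e.far (𝓑.e.R + 1)), |ψ x| ≤ C ∧ |χ x| ≤ C) ∧ ∃ x ∈ 𝓑.doc, ψ x ≠ 0 ∨ χ x ≠ 0

/-- **Without `ν > 0` the crux is a theorem** (witness: the constant pair `(ψ, χ) = (1, 0)` with
`ν = ω = 0`; constants solve `□_g ψ = 0` by `PseudoRiemannianMetric.dalembertian_const`, have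
`dψ(T) = 0`, are bounded, and `ψ ≠ 0` at the point `γ 0 ∈ K ⊆ doc`). So all the content of
`ErgoregionBomb` is the strict growth rate. [folklore] -/
theorem ergoregionBombWithoutPos_holds : ErgoregionBombWithoutPos := by
  intro 𝓑 _ _ _ _ _ _ _ γ K _ _ _ hKd hin
  refine ⟨0, 0, fun _ ↦ 1, fun _ ↦ 0, le_rfl, ⟨Set.univ, isOpen_univ, Set.subset_univ _,
    contMDiffOn_const, contMDiffOn_const⟩, ?_, ?_, ⟨1, fun x _ ↦ by simp⟩,
    ⟨γ 0, hKd (hin 0 le_rfl), Or.inl one_ne_zero⟩⟩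
  · intro x _
    exact ⟨PseudoRiemannianMetric.dalembertian_const _ 1 x,
      PseudoRiemannianMetric.dalembertian_const _ 0 x⟩
  · intro x _
    constructor <;> simp [mfderiv_const]
    all_goals rfl


/-! ## §3  Growth law along the stationary flow; tightness of the boundedness region

LANDED (p73443, commit 36b0ab490d26) as `Summits/…/Theorems/ErgoregionBomb/Negative/GrowthLaw.lean`
(namespace `…Theorems.ErgoregionBomb.Negative`, same names); the copies below keep this work file
self-contained. -/

omit [𝓑.metric.HasLeviCivita] in
/-- Chain rule along an integral curve `σ` of the stationary field: `(φ ∘ σ)'(t) = dφ(T)(σ t)`.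
[folklore] -/
theorem hasDerivAt_comp_integralCurve {σ : ℝ → 𝓑.carrier} (hσ : IsMIntegralCurve σ 𝓑.killing)
    {φ : 𝓑.carrier → ℝ} {t : ℝ} (hφ : MDifferentiableAt (𝓡 4) 𝓘(ℝ, ℝ) φ (σ t)) :
    HasDerivAt (fun s ↦ φ (σ s)) (mfderiv (𝓡 4) 𝓘(ℝ, ℝ) φ (σ t) (𝓑.killing (σ t))) t := by
  set L : ℝ →L[ℝ] ℝ := (mfderiv (𝓡 4) 𝓘(ℝ, ℝ) φ (σ t)).comp
    ((1 : ℝ →L[ℝ] ℝ).smulRight (𝓑.killing (σ t))) with hL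
  have h1 : HasMFDerivAt 𝓘(ℝ, ℝ) 𝓘(ℝ, ℝ) (φ ∘ σ) t L := hφ.hasMFDerivAt.comp t (hσ t)
  have h2 : HasFDerivAt (φ ∘ σ) L t := hasMFDerivAt_iff_hasFDerivAt.mp h1
  have h3 : HasDerivAt (φ ∘ σ) (L 1) t := h2.hasDerivAt
  have hL1 : L 1 = mfderiv (𝓡 4) 𝓘(ℝ, ℝ) φ (σ t) (𝓑.killing (σ t)) := by
    show (mfderiv (𝓡 4) 𝓘(ℝ, ℝ) φ (σ t)) ((1 : ℝ) • 𝓑.killing (σ t)) = _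
    rw [one_smul]
  rw [hL1] at h3
  exact h3

omit [𝓑.metric.HasLeviCivita] in
/-- **Growth law, infinitesimal form.** Along an integral curve `σ` of `T`, a pair satisfying the
Killing eigen-equations `dψ(T) = νψ − ωχ`, `dχ(T) = ωψ + νχ` at `σ t` has
`(ψ² + χ²)∘σ` with derivative `2ν (ψ² + χ²)(σ t)` there (real form of `|Ψ ∘ φ_t| = e^{νt}|Ψ|`).
[folklore] -/
theorem modePair_sq_hasDerivAt {σ : ℝ → 𝓑.carrier} (hσ : IsMIntegralCurve σ 𝓑.killing)
    {ψ χ : 𝓑.carrier → ℝ} {ν ω : ℝ} {t : ℝ}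
    (hψd : MDifferentiableAt (𝓡 4) 𝓘(ℝ, ℝ) ψ (σ t))
    (hχd : MDifferentiableAt (𝓡 4) 𝓘(ℝ, ℝ) χ (σ t))
    (hψ : mfderiv (𝓡 4) 𝓘(ℝ, ℝ) ψ (σ t) (𝓑.killing (σ t)) = ν * ψ (σ t) - ω * χ (σ t))
    (hχ : mfderiv (𝓡 4) 𝓘(ℝ, ℝ) χ (σ t) (𝓑.killing (σ t)) = ω * ψ (σ t) + ν * χ (σ t)) :
    HasDerivAt (fun s ↦ ψ (σ s) ^ 2 + χ (σ s) ^ 2)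
      (2 * ν * (ψ (σ t) ^ 2 + χ (σ t) ^ 2)) t := by
  have h1 := hasDerivAt_comp_integralCurve 𝓑 hσ hψd
  have h2 := hasDerivAt_comp_integralCurve 𝓑 hσ hχd
  rw [hψ] at h1
  rw [hχ] at h2
  have h := (h1.mul h1).add (h2.mul h2)
  beta_reduce at h
  have h' : HasDerivAt (fun s ↦ ψ (σ s) ^ 2 + χ (σ s) ^ 2)
      ((ν * ψ (σ t) - ω * χ (σ t)) * ψ (σ t) + ψ (σ t) * (ν * ψ (σ t) - ω * χ (σ t)) +
        ((ω * ψ (σ t) + ν * χ (σ t)) * χ (σ t) + χ (σ t) * (ω * ψ (σ t) + ν * χ (σ t)))) t := by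
    refine h.congr_of_eventuallyEq (Filter.Eventually.of_forall fun s ↦ ?_)
    simp only [pow_two, Pi.add_apply, Pi.mul_apply]
  refine h'.congr_deriv ?_
  ring

omit [𝓑.metric.HasLeviCivita] in
/-- **Growth law, integrated form**: on an order-connected set `J` of parameters along which the
orbit `σ` stays where the eigen-equations hold (and `ψ, χ` are differentiable),
`(ψ² + χ²)(σ t) = e^{2ν(t − t₀)} (ψ² + χ²)(σ t₀)` for `t, t₀ ∈ J`. [folklore] -/
theorem modePair_sq_eq_exp {σ : ℝ → 𝓑.carrier} (hσ : IsMIntegralCurve σ 𝓑.killing)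
    {ψ χ : 𝓑.carrier → ℝ} {ν ω : ℝ} {J : Set ℝ} (hJ : J.OrdConnected)
    (hd : ∀ t ∈ J, MDifferentiableAt (𝓡 4) 𝓘(ℝ, ℝ) ψ (σ t) ∧
      MDifferentiableAt (𝓡 4) 𝓘(ℝ, ℝ) χ (σ t))
    (heig : ∀ t ∈ J, mfderiv (𝓡 4) 𝓘(ℝ, ℝ) ψ (σ t) (𝓑.killing (σ t)) = ν * ψ (σ t) - ω * χ (σ t) ∧
      mfderiv (𝓡 4) 𝓘(ℝ, ℝ) χ (σ t) (𝓑.killing (σ t)) = ω * ψ (σ t) + ν * χ (σ t))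
    {t₀ t : ℝ} (ht₀ : t₀ ∈ J) (ht : t ∈ J) :
    ψ (σ t) ^ 2 + χ (σ t) ^ 2 =
      Real.exp (2 * ν * (t - t₀)) * (ψ (σ t₀) ^ 2 + χ (σ t₀) ^ 2) := by
  have hF : ∀ s ∈ J, HasDerivAt
      (fun s ↦ Real.exp (-(2 * ν) * s) * (ψ (σ s) ^ 2 + χ (σ s) ^ 2)) 0 s := by
    intro s hs
    have hEs := modePair_sq_hasDerivAt 𝓑 hσ (hd s hs).1 (hd s hs).2 (heig s hs).1 (heig s hs).2
    have hexp : HasDerivAt (fun s ↦ Real.exp (-(2 * ν) * s))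
        (Real.exp (-(2 * ν) * s) * (-(2 * ν))) s := by
      have h := ((hasDerivAt_id s).const_mul (-(2 * ν))).exp
      simpa using h
    have h := hexp.mul hEs
    beta_reduce at h
    refine h.congr_deriv ?_
    ring
  have hconst := apply_eq_apply_of_hasDerivAt_zero hJ hF ht ht₀
  beta_reduce at hconst
  calc ψ (σ t) ^ 2 + χ (σ t) ^ 2
      = Real.exp (2 * ν * t) * (Real.exp (-(2 * ν) * t) * (ψ (σ t) ^ 2 + χ (σ t) ^ 2)) := by
        rw [← mul_assoc, ← Real.exp_add, show 2 * ν * t + -(2 * ν) * t = 0 by ring,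
          Real.exp_zero, one_mul]
    _ = Real.exp (2 * ν * t) * (Real.exp (-(2 * ν) * t₀) * (ψ (σ t₀) ^ 2 + χ (σ t₀) ^ 2)) := by
        rw [hconst]
    _ = Real.exp (2 * ν * (t - t₀)) * (ψ (σ t₀) ^ 2 + χ (σ t₀) ^ 2) := by
        rw [← mul_assoc, ← Real.exp_add,
          show 2 * ν * t + -(2 * ν) * t₀ = 2 * ν * (t - t₀) by ring]

omit [𝓑.metric.HasLeviCivita] in
/-- **Tightness of the boundedness region.** For `ν > 0`, a pair satisfying the eigen-equations along
the FORWARD half `σ([t₀, ∞))` of a `T`-orbit and bounded there vanishes at `σ t₀`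
(`e^{2ν(t−t₀)}(ψ₀² + χ₀²) ≤ 2C²` for all `t ≥ t₀` forces `ψ₀ = χ₀ = 0`). So the conclusion of the crux
can only be met because its bound is imposed on `doc ∩ I⁻(far slice region)`, which contains no
forward-complete `T`-orbit; the strengthening "bounded on the whole d.o.c." kills every growing
mode (next theorem). [folklore] -/
theorem modePair_eq_zero_of_bounded_forward_orbit {σ : ℝ → 𝓑.carrier}
    (hσ : IsMIntegralCurve σ 𝓑.killing) {ψ χ : 𝓑.carrier → ℝ} {ν ω : ℝ} (hν : 0 < ν) {t₀ : ℝ}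
    (hd : ∀ t, t₀ ≤ t → MDifferentiableAt (𝓡 4) 𝓘(ℝ, ℝ) ψ (σ t) ∧
      MDifferentiableAt (𝓡 4) 𝓘(ℝ, ℝ) χ (σ t))
    (heig : ∀ t, t₀ ≤ t → mfderiv (𝓡 4) 𝓘(ℝ, ℝ) ψ (σ t) (𝓑.killing (σ t)) = ν * ψ (σ t) - ω * χ (σ t) ∧
      mfderiv (𝓡 4) 𝓘(ℝ, ℝ) χ (σ t) (𝓑.killing (σ t)) = ω * ψ (σ t) + ν * χ (σ t))
    {C : ℝ} (hb : ∀ t, t₀ ≤ t → |ψ (σ t)| ≤ C ∧ |χ (σ t)| ≤ C) :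
    ψ (σ t₀) = 0 ∧ χ (σ t₀) = 0 := by
  set E₀ := ψ (σ t₀) ^ 2 + χ (σ t₀) ^ 2 with hE₀
  have hE₀nn : 0 ≤ E₀ := by positivity
  have hbound : ∀ t, t₀ ≤ t → Real.exp (2 * ν * (t - t₀)) * E₀ ≤ 2 * C ^ 2 := by
    intro t ht
    rw [← modePair_sq_eq_exp 𝓑 hσ Set.ordConnected_Ici (fun s hs ↦ hd s hs) (fun s hs ↦ heig s hs)
      (Set.mem_Ici.2 le_rfl) (Set.mem_Ici.2 ht)]
    obtain ⟨h1, h2⟩ := hb t ht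
    have h1' : ψ (σ t) ^ 2 ≤ C ^ 2 := by
      simpa only [sq_abs] using pow_le_pow_left₀ (abs_nonneg _) h1 2
    have h2' : χ (σ t) ^ 2 ≤ C ^ 2 := by
      simpa only [sq_abs] using pow_le_pow_left₀ (abs_nonneg _) h2 2
    linarith
  have hE₀z : E₀ = 0 := by
    by_contra hne
    have hpos : 0 < E₀ := lt_of_le_of_ne hE₀nn (Ne.symm hne)
    -- choose `t` with `2ν(t − t₀) = (2C² + 1)/E₀`
    set s : ℝ := (2 * C ^ 2 + 1) / E₀ / (2 * ν) with hs
    have hsnn : 0 ≤ s := by positivity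
    have h := hbound (t₀ + s) (by linarith)
    have hexp : 2 * ν * (t₀ + s - t₀) + 1 ≤ Real.exp (2 * ν * (t₀ + s - t₀)) :=
      Real.add_one_le_exp _
    have hid : 2 * ν * (t₀ + s - t₀) = (2 * C ^ 2 + 1) / E₀ := by
      rw [hs]; field_simp; ring
    rw [hid] at hexp h
    have h3 : ((2 * C ^ 2 + 1) / E₀ + 1) * E₀ ≤ 2 * C ^ 2 :=
      le_trans (mul_le_mul_of_nonneg_right hexp hE₀nn) h
    have h4 : ((2 * C ^ 2 + 1) / E₀ + 1) * E₀ = 2 * C ^ 2 + 1 + E₀ := by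
      field_simp
    linarith
  have hψ0 : ψ (σ t₀) ^ 2 = 0 := by nlinarith [sq_nonneg (ψ (σ t₀)), sq_nonneg (χ (σ t₀))]
  have hχ0 : χ (σ t₀) ^ 2 = 0 := by nlinarith [sq_nonneg (ψ (σ t₀)), sq_nonneg (χ (σ t₀))]
  exact ⟨pow_eq_zero_iff (n := 2) (by norm_num) |>.mp hψ0,
    pow_eq_zero_iff (n := 2) (by norm_num) |>.mp hχ0⟩

/-- **The strengthening "bounded on the whole d.o.c." has no non-trivial solution** on any hole whose
d.o.c. is forward-invariant under the stationary flow (hypothesis `hinv`; classically automatic: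
`φ_t` are time-orientation preserving isometries fixing `M_ext`): a `ν > 0` Killing-mode pair,
smooth near the d.o.c. and bounded on ALL of `𝓑.doc`, vanishes on `𝓑.doc`. Hence the variant of
the crux with `doc ∩ I⁻(far slice region)` replaced by `doc` in the boundedness clause has an
unsatisfiable conclusion and collapses to the rigidity-type statement "no telescope hole has a
trapped zero-energy ray". [folklore] -/
theorem modePair_eq_zero_of_bounded_on_doc
    (hinv : ∀ σ : ℝ → 𝓑.carrier, IsMIntegralCurve σ 𝓑.killing → σ 0 ∈ 𝓑.doc →
      ∀ t : ℝ, 0 ≤ t → σ t ∈ 𝓑.doc)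
    {ν ω : ℝ} {ψ χ : 𝓑.carrier → ℝ} (hν : 0 < ν)
    (hU : ∃ U : Set 𝓑.carrier, IsOpen U ∧ 𝓑.doc ∪ 𝓑.horizon ⊆ U ∧
      ContMDiffOn (𝓡 4) 𝓘(ℝ, ℝ) ((⊤ : ℕ∞) : WithTop ℕ∞) ψ U ∧
      ContMDiffOn (𝓡 4) 𝓘(ℝ, ℝ) ((⊤ : ℕ∞) : WithTop ℕ∞) χ U)
    (heig : ∀ x ∈ 𝓑.doc, mfderiv (𝓡 4) 𝓘(ℝ, ℝ) ψ x (𝓑.killing x) = ν * ψ x - ω * χ x ∧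
      mfderiv (𝓡 4) 𝓘(ℝ, ℝ) χ x (𝓑.killing x) = ω * ψ x + ν * χ x)
    (hb : ∃ C : ℝ, ∀ x ∈ 𝓑.doc, |ψ x| ≤ C ∧ |χ x| ≤ C) :
    ∀ x ∈ 𝓑.doc, ψ x = 0 ∧ χ x = 0 := by
  intro x hx
  obtain ⟨U, hUo, hsub, hψ, hχ⟩ := hU
  obtain ⟨C, hC⟩ := hb
  obtain ⟨σ, hσ, hσ0⟩ := 𝓑.isStationaryKilling.isCompleteVectorField x
  have hdoc : ∀ t, 0 ≤ t → σ t ∈ 𝓑.doc := hinv σ hσ (hσ0 ▸ hx)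
  have hdiff : ∀ t, (0 : ℝ) ≤ t → MDifferentiableAt (𝓡 4) 𝓘(ℝ, ℝ) ψ (σ t) ∧
      MDifferentiableAt (𝓡 4) 𝓘(ℝ, ℝ) χ (σ t) := by
    intro t ht
    have hmem : U ∈ 𝓝 (σ t) := hUo.mem_nhds (hsub (Or.inl (hdoc t ht)))
    exact ⟨(hψ.contMDiffAt hmem).mdifferentiableAt (by simp),
      (hχ.contMDiffAt hmem).mdifferentiableAt (by simp)⟩
  have h := modePair_eq_zero_of_bounded_forward_orbit 𝓑 hσ hν (t₀ := 0) hdiff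
    (fun t ht ↦ heig (σ t) (hdoc t ht)) (fun t ht ↦ hC (σ t) (hdoc t ht))
  rwa [hσ0] at h

end Summit.FinalStateConjecture.FinalStateConjecture.Cruxes.ErgoregionBomb.Disproof

end
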